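import Summits.QuantumFields.BalabanUV.Beta.GAN24.TorusJunction

/-!
# `BalabanUV.Beta.GAN24.TorusGaugeDefect` — binder row G-an2-4 / (CONV-C), S6 dictionary, a COROLLARY of the junction (leaf-18, after P1-L13b):
# **an2's periodised weak-gauge minimiser column and Bałaban's `H_k` column have THE SAME CURVATURE on every torus** —
# `∂ (colA b − colB b) = 0`: they differ by a CURL-FREE fine field in `ker Q_k` (the kernel form of «equal up to a pure-gauge term»,
# p3's WOODBURY-FIBRE R7′(c) / GAPS C-gan24p2-5 (b)(i)), so the FIELD legs of the K-slot are NOT a dictionary matter while every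
# gauge-invariant (curvature) functional of the two minimisers agrees exactly

NOT IN PRINT; OUR PROOF.  HONEST FRAMING (cell contract, verbatim): «discharging `BetaPertH` makes Bałaban's UV stability UNCONDITIONAL — a
real constructive-QFT result; it is NOT the continuum limit and NOT the Clay problem.»  HONEST DEPENDENCY (verbatim): «continuum YM on T⁴ ⇐
BetaPertH ∧ nine spine estimates (0/9 proved); BetaPertH ⇐ (D1) ∧ (D4) ∧ CAP+tail; G-an2-4 gates asym, D1 and NE2/3/4.»  Cites nothing, mints
no fact, instantiates no binder; linear algebra over `GAN24/TorusJunction` (`QvOp_colA`, `weak_colA`, `QvOp_colB`, `weak_colB`) and Mathlib's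
`dotProduct_star_self_eq_zero` (ℂ with its star order).  NOT summit progress.

CONTENTS (0 sorry): `QvOp_colA_sub_colB` (the difference lies in `ker Q_k`), `curl_sq_sub_eq_zero` (`‖∂(colA b − colB b)‖² = 0`),
**`curl_colA_sub_colB`** (`CurlOp *ᵥ (colA b − colB b) = 0`), `curl_colA_eq_curl_colB`.  READING: together with
`TorusJunction.gram_colA_eq_gram_colB` this is the complete content of the Gram argument — equal constraints + weak criticality on both sides ⇒
equal curvatures (hence equal curl energies / multiplier blocks), the fields themselves differing by the two lineages' GAUGE CHOICES (an2: weak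
block-Landau rows; b05: `R∂*A = 0`) inside `ker Q_k ∩ ker ∂`.  NOT the ff/fm blocks of the K-slot, NOT `ConvCKWall`, NOT `BetaPertH`, NOT
continuum, NOT Clay.  Unit b2b-balaban-gan24-formalise-leaf-18 (gen 5), 2026-08-20.
-/

open Finset
open scoped BigOperators ComplexConjugate Matrix ComplexOrder

namespace Summit.QuantumFields.BalabanUV.Beta.GAN24.TorusGaugeDefect

open Literature.MathematicalPhysics.QuantumFieldTheory
open Literature.MathematicalPhysics.QuantumFieldTheory.Balaban1983to89
open Literature.MathematicalPhysics.QuantumFieldTheory.Balaban1983to89.Beta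
open B5Prop11Plancherel (Tor fine)
open B5Block118 (QvOp)
open B5Action121 (CurlOp)
open Summit.QuantumFields.BalabanUV.Beta.GAN24.TorusJunction (colA colB QvOp_colA QvOp_colB weak_colA weak_colB)

noncomputable section

variable {d : ℕ} (N : ℕ) [NeZero N] (hN : 1 ≤ N) (M : Fin (d + 1) → ℕ) [∀ ν, NeZero (M ν)] (a : ℝ) (ha : 0 < a)

/-- The difference of the two columns lies in `ker Q_k` (both carry the datum `N^{−(d+2)} e_b`). -/
theorem QvOp_colA_sub_colB (b : Tor M × Fin (d + 1)) : QvOp N M *ᵥ (colA N M b - colB N hN M a ha b) = 0 := by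
  rw [Matrix.mulVec_sub, QvOp_colA, QvOp_colB, sub_self]

/-- `‖∂(colA b − colB b)‖² = 0`: pair the difference (in `ker Q_k`) against the weak criticality of BOTH columns. -/
theorem curl_sq_sub_eq_zero (b : Tor M × Fin (d + 1)) :
    star (CurlOp (fine N M) (N : ℂ) *ᵥ (colA N M b - colB N hN M a ha b))
      ⬝ᵥ (CurlOp (fine N M) (N : ℂ) *ᵥ (colA N M b - colB N hN M a ha b)) = 0 := by
  have hw := QvOp_colA_sub_colB N hN M a ha b
  have h1 := weak_colA N M b _ hw
  have h2 := weak_colB N hN M a ha b _ hw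
  rw [Matrix.mulVec_sub (CurlOp (fine N M) (N : ℂ)) (colA N M b), dotProduct_sub, ← Matrix.mulVec_sub, h1, h2, sub_self]

/-- **THE TWO MINIMISERS HAVE THE SAME CURVATURE**: `∂ (colA b − colB b) = 0` on every torus, every blocking `N`, every `d`. -/
theorem curl_colA_sub_colB (b : Tor M × Fin (d + 1)) :
    CurlOp (fine N M) (N : ℂ) *ᵥ (colA N M b - colB N hN M a ha b) = 0 :=
  dotProduct_star_self_eq_zero.1 (curl_sq_sub_eq_zero N hN M a ha b)

/-- Equivalently `∂ (colA b) = ∂ (colB b)`: the plaquette fields of an2's periodised weak-gauge minimiser and of Bałaban's `H_k (N^{−(d+2)} e_b)` coincide. -/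
theorem curl_colA_eq_curl_colB (b : Tor M × Fin (d + 1)) :
    CurlOp (fine N M) (N : ℂ) *ᵥ colA N M b = CurlOp (fine N M) (N : ℂ) *ᵥ colB N hN M a ha b := by
  have h := curl_colA_sub_colB N hN M a ha b
  rw [Matrix.mulVec_sub, sub_eq_zero] at h
  exact h

end

end Summit.QuantumFields.BalabanUV.Beta.GAN24.TorusGaugeDefect
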